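import Summits.HubbardSuperconductivity.HubbardSuperconductivity.Theses.LogColdTorus
import Literature.MathematicalPhysics.QuantumLattice.HubbardTorusFluxThermalBlochBound
import Literature.MathematicalPhysics.QuantumLattice.HubbardLiebConfig
import HarnessLib

/-!
# Route `LogColdTorus`, crux `LogColdDWaveOrder` (stmt-HubbardSuperconductivity-8807), line `registered`:
# the ceiling `ρ ≤ 2` on the log-cold stiffness stub

Support file for the registered skeleton `Cruxes/LogColdDWaveOrder/Lines/birth.lean`
(stubs `stub_logColdStiffness` = S1, `stub_stiffnessToOrderAtThreshold` = S2).

`logColdStiffness_le_two` — **ceiling on S1**: whatever data `(δ, U₁, U₂, κ₀, ρ)` realise the body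
of `stub_logColdStiffness` (`Re Z(θ) ≤ e^{-ρθ²κ log L} Re Z(0)` on `|θ| ≤ π/2`, every `κ ≥ κ₀`,
eventually in even `L`, uniformly on the window, on the `(N_L, S^z = 0)` coordinate sector of
`hubbardTorus 2 L 1 U` / `hubbardTorusFlux L U θ`), necessarily `ρ ≤ 2`: the log-cold stiffness
cannot exceed Bloch's kinetic bound (the thermal Bloch bound
`Literature.MathematicalPhysics.QuantumLattice.exp_mul_re_partitionFn_toBlock_hubbardTorus_le` of
`Literature/…/HubbardTorusFluxThermalBlochBound.lean`, read at `κ = κ₀`, `U = (U₁+U₂)/2`,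
`θ = π/2` and one large even `L`, on the sector shown NON-EMPTY by `nonempty_cruxSector`). So S1 is
consistent with — and not settled by — the only a-priori flux inequality available; its content
`0 < ρ` (a positive helicity modulus at `T_L = 1/(κ log L)`) is the superconducting window itself.

Sources: D. Bohm, Phys. Rev. 75 (1949) 502; D. J. Scalapino, S. R. White, S. Zhang, PRB 47 (1993)
7995 (`D_s` from the flux dependence of the free energy, bounded by the kinetic energy);
H. Watanabe, J. Stat. Phys. 177 (2019) 717, §2.2, §4.1. All [folklore]; no new definition.
-/

-- the mandated namespace `Summit.<Summit>.<Problem>.Theorems` repeats `HubbardSuperconductivity`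
-- (single-problem summit, D-0017), which the `dupNamespace` linter flags on every declaration
set_option linter.dupNamespace false

noncomputable section

namespace Summit.HubbardSuperconductivity.HubbardSuperconductivity.Theorems.LogColdTorus

open Matrix Finset Literature.MathematicalPhysics.QuantumLattice
  Literature.MathematicalPhysics.QuantumFieldTheory
open scoped ComplexConjugate ComplexOrder

/-! ### The ceiling `ρ ≤ 2` on the log-cold stiffness stub -/

section Ceiling

variable {Λ : Type*} [LinearOrder Λ] [Fintype Λ]

/-- The up electrons of `α↑ ∪ β↓` are `α↑ = pairSet α ∅`. [folklore] -/
theorem filter_spin_zero_pairSet (α β : Finset Λ) :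
    (pairSet α β).filter (fun i => (ofLex i).2 = 0) = pairSet α ∅ := by
  ext i
  simp only [Finset.mem_filter, mem_pairSet, Finset.notMem_empty, and_false, or_false]
  constructor
  · rintro ⟨h | h, h0⟩
    · exact h
    · exact absurd (h.1.symm.trans h0) (by decide)
  · intro h
    exact ⟨Or.inl h, h.1⟩

/-- The `(N_L, S^z = 0)` coordinate sector of the crux (`|s| = 2n`, `2 · #{↑ ∈ s} = 2n`) is
non-empty as soon as `n ≤ |Λ|`: take `α↑ ∪ α↓` for any `n`-set `α` of sites. [folklore] -/
theorem nonempty_cruxSector {n : ℕ} (hn : n ≤ Fintype.card Λ) :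
    Nonempty {s : Finset (Orb Λ) //
      s.card = 2 * n ∧ 2 * (s.filter fun i => (ofLex i).2 = 0).card = 2 * n} := by
  obtain ⟨α, -, hα⟩ := Finset.exists_subset_card_eq (s := (Finset.univ : Finset Λ))
    (by simpa using hn)
  refine ⟨⟨pairSet α α, ?_, ?_⟩⟩
  · rw [card_pairSet, hα, two_mul]
  · rw [filter_spin_zero_pairSet, card_pairSet, hα, Finset.card_empty, add_zero]

open scoped Classical in
/-- **Ceiling on the log-cold stiffness stub (S1 ⇒ `ρ ≤ 2`)**: if data `δ ∈ (0,1/4)`,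
`0 < U₁ < U₂`, `κ₀ > 0`, `ρ > 0` realise the body of `stub_logColdStiffness` of the registered
skeleton of crux `LogColdDWaveOrder` — `Re Z_{κ log L}((hubbardTorusFlux L U θ)|_sec) ≤
e^{-ρθ²κ log L} · Re Z_{κ log L}((hubbardTorus 2 L 1 U)|_sec)` for all `|θ| ≤ π/2`, every `κ ≥ κ₀`,
eventually in even `L`, uniformly on the window, on the `(N_L, S^z = 0)` sector — then `ρ ≤ 2`:
read the hypothesis at `κ = κ₀`, `U = (U₁+U₂)/2`, `θ = π/2` and one large even `L`, and compare with
the thermal Bloch bound `exp_mul_re_partitionFn_toBlock_hubbardTorus_le` on the (non-empty) sector.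
Bohm (1949); Scalapino–White–Zhang (1993) (`D_s ≤` kinetic energy). [folklore] -/
theorem logColdStiffness_le_two :
    ∀ δ ∈ Set.Ioo (0:ℝ) (1/4), ∀ (U₁ U₂ κ₀ ρ : ℝ), 0 < U₁ → U₁ < U₂ → 0 < κ₀ → 0 < ρ →
      (∀ κ : ℝ, κ₀ ≤ κ → ∃ L₀ : ℕ, ∀ U ∈ Set.Ioo U₁ U₂, ∀ (L : ℕ) [NeZero L], L₀ ≤ L → Even L →
        ∀ θ : ℝ, |θ| ≤ Real.pi / 2 →
          let p : Finset (Orb (FermionTorus 2 L)) → Prop := fun s =>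
            s.card = 2 * ⌊(1 - δ) * (L : ℝ) ^ 2 / 2⌋₊ ∧
              2 * (s.filter fun i => (ofLex i).2 = 0).card = 2 * ⌊(1 - δ) * (L : ℝ) ^ 2 / 2⌋₊;
          (Matrix.partitionFn (κ * Real.log L) ((hubbardTorusFlux L U θ).toBlock p p)).re ≤
            Real.exp (-(ρ * θ ^ 2 * (κ * Real.log L))) *
              (Matrix.partitionFn (κ * Real.log L) ((hubbardTorus 2 L 1 U).toBlock p p)).re) →
      ρ ≤ 2 := by
  classical
  intro δ hδ U₁ U₂ κ₀ ρ _hU₁ hU₁₂ hκ₀ _hρ hS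
  obtain ⟨L₀, hL₀⟩ := hS κ₀ le_rfl
  -- one large even side
  obtain ⟨L, hLL₀, hL4, hev⟩ : ∃ L : ℕ, L₀ ≤ L ∧ 4 ≤ L ∧ Even L :=
    ⟨2 * (L₀ + 2), by omega, by omega, ⟨L₀ + 2, by ring⟩⟩
  haveI : NeZero L := ⟨by omega⟩
  have hL3 : 3 ≤ L := by omega
  have hL1 : (1 : ℝ) < L := by exact_mod_cast (show 1 < L by omega)
  have hlog : 0 < Real.log L := Real.log_pos hL1
  have hβ : 0 < κ₀ * Real.log L := mul_pos hκ₀ hlog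
  -- the middle of the window and the quarter flux
  have hU : (U₁ + U₂) / 2 ∈ Set.Ioo U₁ U₂ := ⟨by linarith, by linarith⟩
  have hθ : |Real.pi / 2| ≤ Real.pi / 2 := by rw [abs_of_nonneg (by positivity)]
  set n : ℕ := ⌊(1 - δ) * (L : ℝ) ^ 2 / 2⌋₊ with hn
  set p : Finset (Orb (FermionTorus 2 L)) → Prop := fun s =>
    s.card = 2 * n ∧ 2 * (s.filter fun i => (ofLex i).2 = 0).card = 2 * n with hp
  have h : (Matrix.partitionFn (κ₀ * Real.log L)
      ((hubbardTorusFlux L ((U₁ + U₂) / 2) (Real.pi / 2)).toBlock p p)).re ≤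
      Real.exp (-(ρ * (Real.pi / 2) ^ 2 * (κ₀ * Real.log L))) *
        (Matrix.partitionFn (κ₀ * Real.log L)
          ((hubbardTorus 2 L 1 ((U₁ + U₂) / 2)).toBlock p p)).re :=
    hL₀ _ hU L hLL₀ hev _ hθ
  -- the thermal Bloch bound on the same sector
  have hB := exp_mul_re_partitionFn_toBlock_hubbardTorus_le hL3 ((U₁ + U₂) / 2) (Real.pi / 2)
    hβ.le p
  -- the sector is non-empty, so `Re Z(0) > 0`
  have hnL : n ≤ Fintype.card (FermionTorus 2 L) := by
    have hcardT : Fintype.card (FermionTorus 2 L) = L ^ 2 := by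
      simp [FermionTorus, Fintype.card_lex]
    rw [hcardT, hn]
    refine Nat.floor_le_of_le ?_
    have h0 : (0 : ℝ) ≤ (L : ℝ) ^ 2 := by positivity
    have hδ1 : 0 ≤ δ := hδ.1.le
    push_cast
    nlinarith
  haveI : Nonempty {s // p s} := nonempty_cruxSector hnL
  have hH : (hubbardTorus 2 L 1 ((U₁ + U₂) / 2)).IsHermitian :=
    hubbardTorus_isHermitian (hamiltonian_isHermitian_and_commute_holds _) 1 _
  have hZ0 : 0 < (Matrix.partitionFn (κ₀ * Real.log L)
      ((hubbardTorus 2 L 1 ((U₁ + U₂) / 2)).toBlock p p)).re :=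
    partitionFn_re_pos (hH.submatrix _) _
  -- compare the two exponential factors
  have hcomp : Real.exp (-(2 * (κ₀ * Real.log L) * (Real.pi / 2) ^ 2)) ≤
      Real.exp (-(ρ * (Real.pi / 2) ^ 2 * (κ₀ * Real.log L))) :=
    le_of_mul_le_mul_right (hB.trans h) hZ0
  rw [Real.exp_le_exp, neg_le_neg_iff] at hcomp
  have hk : 0 < (Real.pi / 2) ^ 2 * (κ₀ * Real.log L) := by positivity
  nlinarith

end Ceiling

end Summit.HubbardSuperconductivity.HubbardSuperconductivity.Theorems.LogColdTorus

end
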